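import Mathlib
import Literature.Analysis.FluidPDE.SuitableWeak
import Summits.NavierStokesRegularity.OSWSelfSimilar.TypeIIModulationDictionary
import HarnessLib
/-!
# The MODULATION DICTIONARY of the Type-II (log-)modulated similarity ansatz, II: the two law classes
# (zone Z1 TEMPLATE §T1.2 (N3), §T1.4 (C11); Hou 2022's fitted row — kernel-checked)

HONEST FRAMING (cell ns-blowup GROUP B, zone Z1; D-0035/D-0074): one-variable calculus of `HOME/profile/z1/TEMPLATE.md` (N3),
continued from `TypeIIModulationDictionary.lean` (same conventions: `T`, `λ`, `τ = ∫λ⁻²dt`, `a = −½ d(λ²)/dt`, forward mean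
`ā = λ²/(2(T−t))`). **Nothing here is a statement about Navier–Stokes**; the one lemma naming the tree's
`Literature.Analysis.FluidPDE.IsTypeIBlowup` is about an ARBITRARY field gauged by the log-modulated scale and exhibits no
such field. «violates: n/a — dictionary»; bears_on LADDER-NS N5/Z1 → N1 linear core / N0⁻.

* §3 POWER-LAW TYPE II, `a(τ) = κ/τ` (TEMPLATE (N3) rows 1–2): `exp(−∫_{τ₀}^τ κ/s) = (τ/τ₀)^{−κ}`
  (`exp_neg_integral_powerLaw`), `λ = λ₀(τ/τ₀)^{−κ}` solves `dλ/dτ = −(κ/τ)λ` (`hasDerivAt_powerLawScale`); `λ²` is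
  integrable at `∞` iff `κ > ½` (`integrableOn_powerLawScale_sq_iff` — for `κ ≤ ½` NO finite singular time); for `κ > ½`:
  `T − t(τ) = λ₀²τ₀^{2κ}τ^{1−2κ}/(2κ−1)` (`remaining_time_powerLaw`), the Type-I quantity is `τ/(2κ−1)` — unbounded, TYPE II
  (`typeI_quantity_powerLaw`), and `(T−t)^{c}‖u‖_∞` is constant for `c = κ/(2κ−1)` (`remaining_rpow_mul_inv_scale_powerLaw`);
  exponent algebra `½ < c` (`half_lt_rateExponent`), `c < 1 ↔ κ > 1`, `c < ¾ ↔ κ > 3/2` (TEMPLATE (C11)'s threshold) and the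
  (C11) budget integral `∫^∞ τ^{½−κ}dτ < ∞ ↔ κ > 3/2` (`integrableOn_dissipationBudget_iff`).
* §4 LOG-MODULATED PARABOLIC, `λ(t)² = (T−t)·L^{−2κ′}`, `L := −log(T−t)` (TEMPLATE (N3) row 3 — the Z1 namesake; Hou
  2022's fitted `‖ω‖_∞ ∼ |log(T−t)|/(T−t)` is `κ′ = ½` in the vorticity gauge `λ_ω = ‖ω‖_∞^{−1/2}`): `dL/dt = (T−t)⁻¹`
  (`hasDerivAt_negLog`); `d(λ²)/dt = −L^{−2κ′}(1 + 2κ′/L)`, i.e. `a = ½L^{−2κ′}(1 + 2κ′/L)` (`modulation_logModulated`); the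
  clock `τ = L^{2κ′+1}/(2κ′+1)` has `dτ/dt = λ⁻²` (`hasDerivAt_logModulatedClock`); `ā = ½L^{−2κ′}` (`forwardMean_logModulated`)
  `→ 0` as `t ↑ T` for `κ′ > 0` (`tendsto_forwardMean_logModulated`), so a field gauged by this `λ` is NOT Type I
  (`not_isTypeIBlowup_logModulated`, via part I); in the clock, `½L^{−2κ′} = c₀ τ^{−γ}` EXACTLY with `γ = 2κ′/(2κ′+1)`,
  `c₀ = ½(2κ′+1)^{−γ}` (`modulation_logModulated_clock`; inverse `kappa'_of_gamma`; `0 ≤ γ < 1`, `gamma_lt_one`), so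
  `a = c₀τ^{−γ}(1 + 2κ′/L) ∼ c₀τ^{−γ}`; Hou's row `κ′ = ½ ⇒ γ = ½, c₀ = 8^{−1/2}`, i.e. `a ≈ (8τ)^{−1/2}` (`hou_row_c0`).

WHAT IS NOT HERE: any fluid; TEMPLATE (L6)'s heuristic for WHICH class occurs (scaling mode cut off at `|y| ~ a^{−1/2}`) is
not computable (inner object = open Liouville counterexample). Author: ns-blowup-profile-eng-1 g4, 2026-08-26.
-/

open Real Filter Topology MeasureTheory Set intervalIntegral

namespace Summit.NavierStokesRegularity.OSWSelfSimilar
namespace TypeIIModulationDictionary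

/-! ## §3 The power-law Type-II class `a(τ) = κ/τ` (TEMPLATE (N3) first two rows, (C11)) -/

/-- `a = κ/τ`: the exponential of (N1) is a power, `exp(−∫_{τ₀}^τ κ/s ds) = (τ/τ₀)^{−κ}` (`τ, τ₀ > 0`).
[new here — dictionary] -/
theorem exp_neg_integral_powerLaw {κ τ0 τ : ℝ} (hτ0 : 0 < τ0) (hτ : 0 < τ) :
    Real.exp (-(∫ s in τ0..τ, κ / s)) = (τ / τ0) ^ (-κ) := by
  have h1 : (∫ s in τ0..τ, κ / s) = κ * Real.log (τ / τ0) := by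
    have : (fun s : ℝ => κ / s) = fun s => κ * s⁻¹ := by funext s; rw [div_eq_mul_inv]
    rw [this, intervalIntegral.integral_const_mul, integral_inv_of_pos hτ0 hτ]
  rw [h1, Real.rpow_def_of_pos (div_pos hτ hτ0)]
  congr 1; ring

/-- **(N3) row 1, scale.** `λ(τ) = λ₀ (τ/τ₀)^{−κ}` solves `dλ/dτ = −(κ/τ) λ` for `τ > 0`. [new here — dictionary] -/
theorem hasDerivAt_powerLawScale (lam0 κ : ℝ) {τ0 τ : ℝ} (hτ0 : 0 < τ0) (hτ : 0 < τ) :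
    HasDerivAt (fun σ => lam0 * (σ / τ0) ^ (-κ)) (-(κ / τ) * (lam0 * (τ / τ0) ^ (-κ))) τ := by
  have hq : 0 < τ / τ0 := div_pos hτ hτ0
  have h1 : HasDerivAt (fun σ : ℝ => σ / τ0) (1 / τ0) τ := by
    simpa using (hasDerivAt_id τ).div_const τ0
  have h2 : HasDerivAt (fun σ : ℝ => (σ / τ0) ^ (-κ)) ((1 / τ0) * (-κ) * (τ / τ0) ^ (-κ - 1)) τ :=
    h1.rpow_const (Or.inl hq.ne')
  have h3 := h2.const_mul lam0
  refine h3.congr_deriv ?_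
  rw [Real.rpow_sub_one hq.ne']
  field_simp

/-- **(N3) rows 1–2, the clock decides finite time.** `λ(τ)² = λ₀²(τ/τ₀)^{−2κ}` is integrable on `(τ₀, ∞)` iff `κ > ½`
(`λ₀ ≠ 0`, `τ₀ > 0`): for `κ ≤ ½` the ansatz `a = κ/τ` reaches NO finite singular time («infinite-time collapse»).
[new here — dictionary] -/
theorem integrableOn_powerLawScale_sq_iff {lam0 κ τ0 : ℝ} (hlam0 : lam0 ≠ 0) (hτ0 : 0 < τ0) :
    IntegrableOn (fun σ => (lam0 * (σ / τ0) ^ (-κ)) ^ 2) (Ioi τ0) ↔ 1 / 2 < κ := by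
  have hcongr : EqOn (fun σ => (lam0 * (σ / τ0) ^ (-κ)) ^ 2)
      (fun σ => (lam0 ^ 2 * τ0 ^ (2 * κ)) * σ ^ (-(2 * κ))) (Ioi τ0) := by
    intro σ hσ
    have hσ' : 0 < σ := hτ0.trans hσ
    simp only
    rw [mul_pow, Real.div_rpow hσ'.le hτ0.le, div_pow, ← Real.rpow_natCast ((σ : ℝ) ^ (-κ)),
      ← Real.rpow_natCast ((τ0 : ℝ) ^ (-κ)), ← Real.rpow_mul hσ'.le, ← Real.rpow_mul hτ0.le]
    push_cast
    rw [show -κ * 2 = -(2 * κ) by ring, Real.rpow_neg hτ0.le (2 * κ)]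
    field_simp
  rw [integrableOn_congr_fun hcongr measurableSet_Ioi]
  have hc : lam0 ^ 2 * τ0 ^ (2 * κ) ≠ 0 := mul_ne_zero (pow_ne_zero 2 hlam0) (Real.rpow_pos_of_pos hτ0 _).ne'
  rw [IntegrableOn, integrable_const_mul_iff (isUnit_iff_ne_zero.mpr hc) (fun σ : ℝ => σ ^ (-(2 * κ))),
    ← IntegrableOn, integrableOn_Ioi_rpow_iff hτ0]
  constructor <;> intro h <;> linarith

/-- **(N3) row 1, remaining time.** For `κ > ½`, `τ ≥ τ₀ > 0`:
`∫_τ^∞ λ₀²(σ/τ₀)^{−2κ} dσ = λ₀² τ₀^{2κ} τ^{1−2κ}/(2κ−1)` — so `T − t(τ) ∝ τ^{1−2κ}`. [new here — dictionary] -/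
theorem remaining_time_powerLaw {lam0 κ τ0 τ : ℝ} (hκ : 1 / 2 < κ) (hτ0 : 0 < τ0) (hτ : τ0 ≤ τ) :
    ∫ σ in Ioi τ, (lam0 * (σ / τ0) ^ (-κ)) ^ 2
      = lam0 ^ 2 * τ0 ^ (2 * κ) * τ ^ (1 - 2 * κ) / (2 * κ - 1) := by
  have hτ' : 0 < τ := hτ0.trans_le hτ
  have hcongr : EqOn (fun σ => (lam0 * (σ / τ0) ^ (-κ)) ^ 2)
      (fun σ => (lam0 ^ 2 * τ0 ^ (2 * κ)) * σ ^ (-(2 * κ))) (Ioi τ) := by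
    intro σ hσ
    have hσ' : 0 < σ := hτ'.trans hσ
    simp only
    rw [mul_pow, Real.div_rpow hσ'.le hτ0.le, div_pow, ← Real.rpow_natCast ((σ : ℝ) ^ (-κ)),
      ← Real.rpow_natCast ((τ0 : ℝ) ^ (-κ)), ← Real.rpow_mul hσ'.le, ← Real.rpow_mul hτ0.le]
    push_cast
    rw [show -κ * 2 = -(2 * κ) by ring, Real.rpow_neg hτ0.le (2 * κ)]
    field_simp
  rw [setIntegral_congr_fun measurableSet_Ioi hcongr, MeasureTheory.integral_const_mul,
    integral_Ioi_rpow_of_lt (by linarith) hτ']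
  rw [show -(2 * κ) + 1 = 1 - 2 * κ by ring]
  have h2 : -τ ^ (1 - 2 * κ) / (1 - 2 * κ) = τ ^ (1 - 2 * κ) / (2 * κ - 1) := by
    rw [neg_div, ← div_neg, neg_sub]
  rw [h2]
  ring

/-- **(N3) row 1, TYPE II.** In the power-law class the Type-I quantity `(T − t)·λ⁻²` equals `τ/(2κ−1)` (unbounded as
`τ → ∞`), equivalently `ā = (2κ−1)/(2τ) → 0`: pure algebra on the two closed forms above (`λ₀, τ₀, τ > 0`, `κ > ½`).
[new here — dictionary] -/
theorem typeI_quantity_powerLaw {lam0 κ τ0 τ : ℝ} (hκ : 1 / 2 < κ) (hlam0 : 0 < lam0) (hτ0 : 0 < τ0) (hτ : 0 < τ) :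
    (lam0 ^ 2 * τ0 ^ (2 * κ) * τ ^ (1 - 2 * κ) / (2 * κ - 1)) / (lam0 * (τ / τ0) ^ (-κ)) ^ 2
      = τ / (2 * κ - 1) := by
  have hq : (lam0 * (τ / τ0) ^ (-κ)) ^ 2 = lam0 ^ 2 * τ0 ^ (2 * κ) * τ ^ (-(2 * κ)) := by
    rw [mul_pow, Real.div_rpow hτ.le hτ0.le, div_pow, ← Real.rpow_natCast ((τ : ℝ) ^ (-κ)),
      ← Real.rpow_natCast ((τ0 : ℝ) ^ (-κ)), ← Real.rpow_mul hτ.le, ← Real.rpow_mul hτ0.le]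
    push_cast
    rw [show -κ * 2 = -(2 * κ) by ring, Real.rpow_neg hτ0.le (2 * κ)]
    field_simp
  rw [hq, show (1 - 2 * κ) = -(2 * κ) + 1 by ring, Real.rpow_add hτ, Real.rpow_one]
  have h1 : (2 * κ - 1) ≠ 0 := by linarith
  have h2 : 0 < τ ^ (-(2 * κ)) := Real.rpow_pos_of_pos hτ _
  have h3 : 0 < τ0 ^ (2 * κ) := Real.rpow_pos_of_pos hτ0 _
  field_simp

/-- **(N3) row 1, the blow-up rate exponent.** With `T − t = A τ^{1−2κ}` and `‖u‖_∞ = λ⁻¹ = λ₀⁻¹(τ/τ₀)^{κ}`, the product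
`(T − t)^{c} ‖u‖_∞` is INDEPENDENT of `τ` (`= A^c λ₀⁻¹ τ₀^{−κ}`) for `c = κ/(2κ−1)`: `‖u(t)‖_∞ ∝ (T−t)^{−c}`
(`A, λ₀, τ₀, τ > 0`, `κ > ½`).
[new here — dictionary] -/
theorem remaining_rpow_mul_inv_scale_powerLaw {A lam0 κ τ0 τ : ℝ} (hκ : 1 / 2 < κ) (hA : 0 < A) (hlam0 : 0 < lam0)
    (hτ0 : 0 < τ0) (hτ : 0 < τ) :
    (A * τ ^ (1 - 2 * κ)) ^ (κ / (2 * κ - 1)) * (lam0 * (τ / τ0) ^ (-κ))⁻¹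
      = A ^ (κ / (2 * κ - 1)) * (lam0⁻¹ * τ0 ^ (-κ)) := by
  have h1 : (2 * κ - 1) ≠ 0 := by linarith
  rw [Real.mul_rpow hA.le (Real.rpow_nonneg hτ.le _), ← Real.rpow_mul hτ.le,
    show (1 - 2 * κ) * (κ / (2 * κ - 1)) = -κ by field_simp; ring,
    Real.div_rpow hτ.le hτ0.le, mul_inv, inv_div]
  have h2 : 0 < τ ^ (-κ) := Real.rpow_pos_of_pos hτ _
  field_simp

/-- The rate exponent `c(κ) := κ/(2κ−1)` of the power-law class exceeds Leray's `½` for every `κ > ½`: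
`c − ½ = 1/(2(2κ−1)) > 0`. [new here — dictionary] -/
theorem half_lt_rateExponent {κ : ℝ} (hκ : 1 / 2 < κ) : 1 / 2 < κ / (2 * κ - 1) := by
  rw [lt_div_iff₀ (by linarith)]; linarith

/-- `c(κ) < 1 ↔ κ > 1` (for `κ > ½`). [new here — dictionary] -/
theorem rateExponent_lt_one_iff {κ : ℝ} (hκ : 1 / 2 < κ) : κ / (2 * κ - 1) < 1 ↔ 1 < κ := by
  rw [div_lt_iff₀ (by linarith)]; constructor <;> intro h <;> linarith

/-- **(C11) corollary's threshold.** `c(κ) < ¾ ↔ κ > 3/2` (for `κ > ½`) — the «‖u‖_∞ ≲ (T−t)^{−3/4}» line of TEMPLATE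
(C11) (DERIVED there under a structural far-field assumption; here only the exponent algebra). [new here — dictionary] -/
theorem rateExponent_lt_threeQuarters_iff {κ : ℝ} (hκ : 1 / 2 < κ) :
    κ / (2 * κ - 1) < 3 / 4 ↔ 3 / 2 < κ := by
  rw [div_lt_iff₀ (by linarith)]; constructor <;> intro h <;> linarith

/-- **(C11) dissipation budget, the integral.** With `a = κ/τ`, `λ ∼ τ^{−κ}` and a dissipation functional `𝒟 ∼ a^{−1/2}
∼ τ^{1/2}`, the budget `∫^∞ λ𝒟 dτ ∼ ∫^∞ τ^{½−κ} dτ` is finite iff `κ > 3/2` (`τ₀ > 0`). [new here — dictionary] -/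
theorem integrableOn_dissipationBudget_iff {κ τ0 : ℝ} (hτ0 : 0 < τ0) :
    IntegrableOn (fun τ : ℝ => τ ^ (1 / 2 - κ)) (Ioi τ0) ↔ 3 / 2 < κ := by
  rw [integrableOn_Ioi_rpow_iff hτ0]; constructor <;> intro h <;> linarith

/-! ## §4 The log-modulated parabolic class `λ² = (T−t)·L^{−2κ′}`, `L = −log(T−t)` (TEMPLATE (N3) row 3; Hou's fit) -/

/-- The logarithm `L(t) := −log(T − t)` has `dL/dt = (T − t)⁻¹` for `t < T`. [new here — dictionary] -/
theorem hasDerivAt_negLog {T t : ℝ} (ht : t < T) :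
    HasDerivAt (fun s => -Real.log (T - s)) ((T - t)⁻¹) t := by
  have h1 : HasDerivAt (fun s : ℝ => T - s) (-1) t := by
    simpa using (hasDerivAt_id t).const_sub T
  have h2 := (h1.log (sub_pos.mpr ht).ne').neg
  refine h2.congr_deriv ?_
  ring

/-- **(N3) row 3, the modulation.** For `t < T` with `T − t < 1` (so `L = −log(T−t) > 0`) and any `κ′`, the scale
`λ(t)² := (T−t)·L^{−2κ′}` has `a := −½ d(λ²)/dt = ½ L^{−2κ′} (1 + 2κ′/L)` — i.e. `d(λ²)/dt = −L^{−2κ′}(1 + 2κ′/L)`.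
(TEMPLATE (N3): «check — L := |log(T−t)|, λ² = (T−t)L^{−2κ′} ⇒ a = ½L^{−2κ′}(1 + 2κ′/L)».) [new here — dictionary] -/
theorem modulation_logModulated {T t κ' : ℝ} (ht : t < T) (h1 : T - t < 1) :
    HasDerivAt (fun s => (T - s) * (-Real.log (T - s)) ^ (-(2 * κ')))
      (-((-Real.log (T - t)) ^ (-(2 * κ')) * (1 + 2 * κ' / (-Real.log (T - t))))) t := by
  have hTt : 0 < T - t := sub_pos.mpr ht
  have hLpos : 0 < -Real.log (T - t) := by rw [neg_pos]; exact Real.log_neg hTt h1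
  have hdL : HasDerivAt (fun s => -Real.log (T - s)) ((T - t)⁻¹) t := hasDerivAt_negLog ht
  have hdLp : HasDerivAt (fun s => (-Real.log (T - s)) ^ (-(2 * κ')))
      ((T - t)⁻¹ * (-(2 * κ')) * (-Real.log (T - t)) ^ (-(2 * κ') - 1)) t :=
    hdL.rpow_const (Or.inl hLpos.ne')
  have hd1 : HasDerivAt (fun s : ℝ => T - s) (-1) t := by
    simpa using (hasDerivAt_id t).const_sub T
  have hprod : HasDerivAt (fun s => (T - s) * (-Real.log (T - s)) ^ (-(2 * κ')))
      (-1 * (-Real.log (T - t)) ^ (-(2 * κ'))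
        + (T - t) * ((T - t)⁻¹ * (-(2 * κ')) * (-Real.log (T - t)) ^ (-(2 * κ') - 1))) t :=
    hd1.mul hdLp
  refine hprod.congr_deriv ?_
  rw [Real.rpow_sub_one hLpos.ne']
  have hTt' : T - t ≠ 0 := hTt.ne'
  generalize hM : -Real.log (T - t) = M at hLpos ⊢
  have hM' : M ≠ 0 := hLpos.ne'
  field_simp
  ring

/-- **(N3) row 3, the clock.** With `L = −log(T−t) > 0` and `2κ′ + 1 ≠ 0`, `τ(t) := L^{2κ′+1}/(2κ′+1)` has
`dτ/dt = L^{2κ′}/(T−t) = λ(t)⁻²` for `λ² = (T−t)L^{−2κ′}` (TEMPLATE (N3): «τ = L^{2κ′+1}/(2κ′+1)»). [new here — dictionary] -/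
theorem hasDerivAt_logModulatedClock {T t κ' : ℝ} (ht : t < T) (h1 : T - t < 1) (hk : 2 * κ' + 1 ≠ 0) :
    HasDerivAt (fun s => (-Real.log (T - s)) ^ (2 * κ' + 1) / (2 * κ' + 1))
      (((T - t) * (-Real.log (T - t)) ^ (-(2 * κ')))⁻¹) t := by
  have hTt : 0 < T - t := sub_pos.mpr ht
  have hLpos : 0 < -Real.log (T - t) := by rw [neg_pos]; exact Real.log_neg hTt h1
  have hdL : HasDerivAt (fun s => -Real.log (T - s)) ((T - t)⁻¹) t := hasDerivAt_negLog ht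
  have h2 := (hdL.rpow_const (p := 2 * κ' + 1) (Or.inl hLpos.ne')).div_const (2 * κ' + 1)
  refine h2.congr_deriv ?_
  rw [show 2 * κ' + 1 - 1 = 2 * κ' by ring, Real.rpow_neg hLpos.le]
  field_simp

/-- **Forward mean of the log-modulated class.** `ā = λ²/(2(T−t)) = ½ L^{−2κ′}` (`t < T`). [new here — dictionary] -/
theorem forwardMean_logModulated {T t κ' : ℝ} (ht : t < T) :
    (T - t) * (-Real.log (T - t)) ^ (-(2 * κ')) / (2 * (T - t)) = (1 / 2) * (-Real.log (T - t)) ^ (-(2 * κ')) := by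
  have hTt : 0 < T - t := sub_pos.mpr ht
  field_simp

/-- `T − t → 0⁺` as `t → T⁻` (elementary filter fact used below). [new here — dictionary] -/
theorem tendsto_sub_nhdsLT {T : ℝ} : Tendsto (fun t : ℝ => T - t) (𝓝[<] T) (𝓝[>] 0) := by
  apply tendsto_nhdsWithin_of_tendsto_nhds_of_eventually_within
  · have : Tendsto (fun t : ℝ => T - t) (𝓝 T) (𝓝 (T - T)) := (tendsto_const_nhds.sub tendsto_id)
    rw [sub_self] at this
    exact this.mono_left nhdsWithin_le_nhds
  · exact eventually_nhdsWithin_of_forall fun t ht => mem_Ioi.mpr (sub_pos.mpr ht)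

/-- `L(t) = −log(T − t) → +∞` as `t → T⁻`. [new here — dictionary] -/
theorem tendsto_negLog_atTop {T : ℝ} : Tendsto (fun t : ℝ => -Real.log (T - t)) (𝓝[<] T) atTop := by
  have h := Real.tendsto_log_nhdsGT_zero.comp (tendsto_sub_nhdsLT (T := T))
  exact tendsto_neg_atBot_atTop.comp h

/-- **(N3) row 3 is TYPE II.** For `κ′ > 0` the forward mean `ā(t) = ½L^{−2κ′} → 0` as `t ↑ T`; equivalently the Type-I
quantity `(T−t)λ⁻² = L^{2κ′} → ∞`. [new here — dictionary] -/
theorem tendsto_forwardMean_logModulated {T κ' : ℝ} (hk : 0 < κ') :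
    Tendsto (fun t : ℝ => (1 / 2 : ℝ) * (-Real.log (T - t)) ^ (-(2 * κ'))) (𝓝[<] T) (𝓝 0) := by
  have h1 : Tendsto (fun t : ℝ => (-Real.log (T - t)) ^ (-(2 * κ'))) (𝓝[<] T) (𝓝 0) :=
    (tendsto_rpow_neg_atTop (by linarith : 0 < 2 * κ')).comp tendsto_negLog_atTop
  simpa using h1.const_mul (1 / 2 : ℝ)

/-- **A field gauged by the log-modulated scale is NOT Type I** (any `κ′ > 0`): if, near `T`, `‖u(t, x)‖` attains (or
exceeds) `λ(t)⁻¹` with `λ(t)² = (T−t)L^{−2κ′}` at some point `x`, then `¬ IsTypeIBlowup u T` — the template's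
`violates: V-T2` holds in this class by `not_isTypeIBlowup_of_forwardMean_lt`. No such field is exhibited here.
[new here — dictionary] -/
theorem not_isTypeIBlowup_logModulated {E : Type*} [NormedAddCommGroup E] {u : ℝ → E → E} {T κ' : ℝ} (hk : 0 < κ')
    (hattain : ∀ᶠ t in 𝓝[<] T,
      ∃ x, (Real.sqrt ((T - t) * (-Real.log (T - t)) ^ (-(2 * κ'))))⁻¹ ≤ ‖u t x‖) :
    ¬ Literature.Analysis.FluidPDE.IsTypeIBlowup u T := by
  set lam : ℝ → ℝ := fun t => Real.sqrt ((T - t) * (-Real.log (T - t)) ^ (-(2 * κ'))) with hlam_def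
  have hlt : ∀ᶠ t in 𝓝[<] T, t < T := eventually_nhdsWithin_of_forall fun t ht => ht
  have hsmall : ∀ᶠ t in 𝓝[<] T, T - t < 1 := by
    have := (tendsto_sub_nhdsLT (T := T)).eventually
      (eventually_nhdsWithin_of_eventually_nhds (p := fun s : ℝ => s < 1) (by
        exact eventually_lt_nhds zero_lt_one))
    exact this
  have hsq : ∀ᶠ t in 𝓝[<] T, 0 < (T - t) * (-Real.log (T - t)) ^ (-(2 * κ')) := by
    filter_upwards [hlt, hsmall] with t h1 h2
    have hTt : 0 < T - t := sub_pos.mpr h1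
    have hLpos : 0 < -Real.log (T - t) := by rw [neg_pos]; exact Real.log_neg hTt h2
    exact mul_pos hTt (Real.rpow_pos_of_pos hLpos _)
  have hlam : ∀ᶠ t in 𝓝[<] T, 0 < lam t := by
    filter_upwards [hsq] with t h using Real.sqrt_pos.mpr h
  refine not_isTypeIBlowup_of_forwardMean_lt (lam := lam) hlam hattain ?_
  intro c hc
  have hmean := tendsto_forwardMean_logModulated (T := T) hk
  have hev : ∀ᶠ t in 𝓝[<] T, (1 / 2 : ℝ) * (-Real.log (T - t)) ^ (-(2 * κ')) < c :=
    hmean (Iio_mem_nhds hc)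
  refine (hev.and (hsq.and hlt)).frequently.mono ?_
  rintro t ⟨h1, h2, h3⟩
  simp only [hlam_def]
  rw [Real.sq_sqrt h2.le, forwardMean_logModulated h3]
  exact h1

/-- **(N3) row 3 in the τ-clock.** With `L > 0`, `0 ≤ κ′`, `γ := 2κ′/(2κ′+1)` and `c₀ := ½(2κ′+1)^{−γ}`, the leading
factor of `a` is an exact power of the clock: `½ L^{−2κ′} = c₀ · (L^{2κ′+1}/(2κ′+1))^{−γ}` — hence
`a(τ) = c₀ τ^{−γ} (1 + 2κ′/L)` with `L → ∞`: `a ∼ c₀ τ^{−γ}`, `0 ≤ γ < 1` (TEMPLATE (N3): «κ′ = γ/(2(1−γ)),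
c₀ = ½(2κ′+1)^{−2κ′/(2κ′+1)}»). [new here — dictionary] -/
theorem modulation_logModulated_clock {L κ' : ℝ} (hL : 0 < L) (hk : 0 ≤ κ') :
    (1 / 2 : ℝ) * L ^ (-(2 * κ'))
      = ((1 / 2 : ℝ) * (2 * κ' + 1) ^ (-(2 * κ' / (2 * κ' + 1))))
        * (L ^ (2 * κ' + 1) / (2 * κ' + 1)) ^ (-(2 * κ' / (2 * κ' + 1))) := by
  have hk1 : 0 < 2 * κ' + 1 := by linarith
  rw [Real.div_rpow (Real.rpow_nonneg hL.le _) hk1.le, ← Real.rpow_mul hL.le,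
    show (2 * κ' + 1) * -(2 * κ' / (2 * κ' + 1)) = -(2 * κ') by field_simp]
  have h2 : 0 < (2 * κ' + 1) ^ (-(2 * κ' / (2 * κ' + 1))) := Real.rpow_pos_of_pos hk1 _
  field_simp

/-- The inverse dictionary: `γ = 2κ′/(2κ′+1)` iff `κ′ = γ/(2(1−γ))` (`2κ′+1 ≠ 0`, `γ ≠ 1`). [new here — dictionary] -/
theorem kappa'_of_gamma {κ' γ : ℝ} (hk : 2 * κ' + 1 ≠ 0) (hγ : γ ≠ 1) :
    γ = 2 * κ' / (2 * κ' + 1) ↔ κ' = γ / (2 * (1 - γ)) := by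
  have hγ' : (1 - γ) ≠ 0 := sub_ne_zero.mpr (Ne.symm hγ)
  constructor
  · intro h
    have h' : γ * (2 * κ' + 1) = 2 * κ' := by rw [h]; exact div_mul_cancel₀ _ hk
    rw [eq_div_iff (mul_ne_zero two_ne_zero hγ')]
    linear_combination (-1 : ℝ) * h'
  · intro h
    rw [eq_div_iff hk, h]
    field_simp
    ring

/-- `0 ≤ γ < 1` for `κ′ ≥ 0`: the log-modulated laws interpolate between Leray's constant `a ≡ ½` (`κ′ = 0`, `γ = 0`)
and the power law `a ∼ c/τ` (`γ → 1`). [new here — dictionary] -/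
theorem gamma_lt_one {κ' : ℝ} (hk : 0 ≤ κ') : 0 ≤ 2 * κ' / (2 * κ' + 1) ∧ 2 * κ' / (2 * κ' + 1) < 1 := by
  have hk1 : 0 < 2 * κ' + 1 := by linarith
  refine ⟨div_nonneg (by linarith) hk1.le, ?_⟩
  rw [div_lt_one hk1]; linarith

/-- **Hou's row (TEMPLATE (N3), (G4)).** Hou 2022's fitted `‖ω‖_∞ ∼ |log(T−t)|/(T−t)` in the vorticity gauge
`λ_ω = ‖ω‖_∞^{−1/2}` is `λ_ω² = (T−t)L^{−1}`, i.e. `κ′ = ½`; then `γ = ½` and `c₀ = ½·2^{−1/2} = 8^{−1/2}`: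
`a ≈ (8τ)^{−1/2}`. (Arithmetic only; no statement about Hou's solution.) [new here — dictionary] -/
theorem hou_row_c0 :
    2 * (1 / 2 : ℝ) / (2 * (1 / 2 : ℝ) + 1) = 1 / 2 ∧
      (1 / 2 : ℝ) * (2 * (1 / 2 : ℝ) + 1) ^ (-(2 * (1 / 2 : ℝ) / (2 * (1 / 2 : ℝ) + 1))) = (8 : ℝ) ^ (-(1 / 2 : ℝ)) := by
  refine ⟨by norm_num, ?_⟩
  have h8 : (8 : ℝ) = 2 ^ (3 : ℝ) := by norm_num
  rw [h8, ← Real.rpow_mul (by norm_num : (0 : ℝ) ≤ 2)]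
  norm_num
  rw [show (-(3 / 2) : ℝ) = -1 + -(1 / 2) by norm_num, Real.rpow_add (by norm_num : (0 : ℝ) < 2),
    Real.rpow_neg_one]
  norm_num

end TypeIIModulationDictionary
end Summit.NavierStokesRegularity.OSWSelfSimilar
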